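import Mathlib

/-!
# SquareDoorPairsM (Mathlib-only twin of SquareDoorPairs) — the square degeneracy door `(2,2)` on FEW semi-homogeneous letters (isogeny-1 g18)

line stmt-HodgeConjecture-18881 Cruxes/BlochSeedDiscOne/Lines/birth.lean 814a6a70c14e831a stub_rung_pad4_seedAt

STATUS SENTENCE. Nothing here is proved toward HC ∕ HC_CM ∕ HC_AV ∕ №4 ∕ 26512 ∕ 18881 ∕ H2; the stub is
untouched; no bundle, map, degeneracy scheme or design is exhibited.  This file types FOUR `ring` identities in
the model ring of `SquareDoorClass.lean` §1 (power sums `p_k = k!·ch_k` of a rank-0 virtual bundle,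
`sqFour = 12·Δ₂₂ = 12·(c₂² − c₁c₃)` = the Thom–Porteous class of the square door `D_{n−2}(φ)`, `φ : 𝓟 → 𝓝`
of equal ranks `n`).  They say what the square-door class IS when the two sides are sums of few
semi-homogeneous letters `r·e^{δ}` (isogeny push-forwards `f_*L`, `r = |det f|²`, slope `δ`; line bundles
`r = 1`), with NO cleanness hypothesis (g17's SCOPE: data dirty in degrees 1–3):

* `sqFour_newton`      — `12Δ₂₂ = p₁⁴ + 3p₂² − 4p₁p₃` (the form used in the g18 memo; `p₁ = c₁(𝓝 − 𝓟)`).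
* `sqFour_pair`        — PAIR LAW: `𝓟 = r·e^{t}`, `𝓝 = r·e^{t+u}` (one letter each side, equal rank `r`, ANY
                          two slopes): `12Δ₂₂ = r²(r² − 1)·u⁴`, `u = δ(𝓝) − δ(𝓟)`.
* `sqFour_two_vs_lines` — `𝓝 = 2·e^{δ}` (a rank-2 letter), `𝓟 = e^{ℓ₁} ⊕ e^{ℓ₂}`:
                          `12Δ₂₂ = 12·(δ − ℓ₁)²(δ − ℓ₂)²`.
* `sqFour_lines_vs_lines` — `𝓝 = e^{ℓ₃} ⊕ e^{ℓ₄}`, `𝓟 = e^{ℓ₁} ⊕ e^{ℓ₂}`: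
                          `12Δ₂₂ = 12·(ℓ₃ − ℓ₁)(ℓ₃ − ℓ₂)(ℓ₄ − ℓ₁)(ℓ₄ − ℓ₂)` (= `c₄(𝓟^∨ ⊗ 𝓝)`, the CE₄ shape).
* `sqFour_c1_zero`     — on the slice `c₁(𝓝 − 𝓟) = 0`: `12Δ₂₂ = 3·p₂²`, a SQUARE.

READING (pen, over the kernel; the seat's memo `RESULT-ISOGENY-Q1Q2-isogeny1-g18.md`).  In each of the first
three shapes the class is DIVISIBLE BY A REAL (1,1)-CLASS (`u`, `δ − ℓ₁`, `ℓ₃ − ℓ₁`).  By THEOREM ID of record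
(isogeny-1 g11, pencil ×2 via memo-92, R19.438: «no real (1,1)-class divides a seed-charged class
`q·h⁴ + μ·w + μ̄·w̄`, `qμ ≠ 0`») every square door with `n ≤ 2`, and every two-letter square door `f_*L → g_*M`
of ANY equal rank and ANY pair of slopes, is dead on the class side — with no (A1)-cleanness and no common
background assumed.  This closes g17's SCOPE crack for these shapes; the first shapes not decided by
SQ-SHUT ∕ SQ-TW ∕ ID are `n = 3` data with ≥ 3 distinct slopes (memo §3: numerically no seed-charged instance
found, pure-Weil instances exist; OPEN).  THEOREM ID itself is NOT typed here (its skeleton of mechanisms is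
`Indivisibility.lean`); this file asserts ring identities only.

Lean: Mathlib only. `SquareDoor.sqFour p₁ p₂ p₃` of the tree UNFOLDS (by `simp only [sqFour, cTwo, cThree]`) to the explicit polynomial
`3·(p₁² − p₂)² − 2·p₁·(p₁³ − 3p₁p₂ + 2p₃)` written out below, so each statement here is literally the unfolded tree statement (no def is
restated; this twin exists only because the farm snapshot serving this seat had `SquareDoorClass` unbuilt);
no `sorry`, no new axioms, no `instance` ∕ `notation`.
-/

namespace HsemiregIsogeny1.SquareDoorPairsM

variable {R : Type*} [CommRing R]

/-- Newton form of the square-door class: `12Δ₂₂ = p₁⁴ + 3p₂² − 4p₁p₃`. -/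
theorem sqFour_newton (p₁ p₂ p₃ : R) :
    3 * ((p₁) ^ 2 - (p₂)) ^ 2 - 2 * (p₁) * ((p₁) ^ 3 - 3 * (p₁) * (p₂) + 2 * (p₃))
      = p₁ ^ 4 + 3 * p₂ ^ 2 - 4 * p₁ * p₃ := by
  ring

/-- PAIR LAW. One semi-homogeneous letter on each side, equal rank `r`, slopes `t` and `t + u`
(power sums `p_k = r(t+u)^k − r t^k`): the square-door class is `r²(r²−1)·u⁴ ∕ 12`, divisible by the
slope difference `u`. -/
theorem sqFour_pair (r t u : R) :
    3 * ((r * (t + u) - r * t) ^ 2 - (r * (t + u) ^ 2 - r * t ^ 2)) ^ 2 - 2 * (r * (t + u) - r * t) * ((r * (t + u) - r * t) ^ 3 - 3 * (r * (t + u) - r * t) * (r * (t + u) ^ 2 - r * t ^ 2) + 2 * (r * (t + u) ^ 3 - r * t ^ 3))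
      = r ^ 2 * (r ^ 2 - 1) * u ^ 4 := by
  ring

/-- A rank-2 letter of slope `δ` against two line bundles `ℓ₁ ⊕ ℓ₂`
(power sums `p_k = 2δ^k − ℓ₁^k − ℓ₂^k`): `12Δ₂₂ = 12(δ − ℓ₁)²(δ − ℓ₂)²`. -/
theorem sqFour_two_vs_lines (δ ℓ₁ ℓ₂ : R) :
    3 * ((2 * δ - ℓ₁ - ℓ₂) ^ 2 - (2 * δ ^ 2 - ℓ₁ ^ 2 - ℓ₂ ^ 2)) ^ 2 - 2 * (2 * δ - ℓ₁ - ℓ₂) * ((2 * δ - ℓ₁ - ℓ₂) ^ 3 - 3 * (2 * δ - ℓ₁ - ℓ₂) * (2 * δ ^ 2 - ℓ₁ ^ 2 - ℓ₂ ^ 2) + 2 * (2 * δ ^ 3 - ℓ₁ ^ 3 - ℓ₂ ^ 3))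
      = 12 * ((δ - ℓ₁) ^ 2 * (δ - ℓ₂) ^ 2) := by
  ring

/-- Two line bundles against two line bundles (power sums `p_k = ℓ₃^k + ℓ₄^k − ℓ₁^k − ℓ₂^k`):
`12Δ₂₂ = 12(ℓ₃ − ℓ₁)(ℓ₃ − ℓ₂)(ℓ₄ − ℓ₁)(ℓ₄ − ℓ₂)` — the top Chern class of `𝓟^∨ ⊗ 𝓝`, the CE₄ shape. -/
theorem sqFour_lines_vs_lines (ℓ₁ ℓ₂ ℓ₃ ℓ₄ : R) :
    3 * ((ℓ₃ + ℓ₄ - ℓ₁ - ℓ₂) ^ 2 - (ℓ₃ ^ 2 + ℓ₄ ^ 2 - ℓ₁ ^ 2 - ℓ₂ ^ 2)) ^ 2 - 2 * (ℓ₃ + ℓ₄ - ℓ₁ - ℓ₂) * ((ℓ₃ + ℓ₄ - ℓ₁ - ℓ₂) ^ 3 - 3 * (ℓ₃ + ℓ₄ - ℓ₁ - ℓ₂) * (ℓ₃ ^ 2 + ℓ₄ ^ 2 - ℓ₁ ^ 2 - ℓ₂ ^ 2) + 2 * (ℓ₃ ^ 3 + ℓ₄ ^ 3 - ℓ₁ ^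 3 - ℓ₂ ^ 3))
      = 12 * ((ℓ₃ - ℓ₁) * (ℓ₃ - ℓ₂) * (ℓ₄ - ℓ₁) * (ℓ₄ - ℓ₂)) := by
  ring

/-- On the slice `c₁(𝓝 − 𝓟) = p₁ = 0` the square-door class is a square: `12Δ₂₂ = 3p₂²`
(`p₂ = 2·ch₂(𝓝 − 𝓟)`, an arbitrary algebraic `(2,2)`-class of the data). -/
theorem sqFour_c1_zero (p₂ p₃ : R) :
    3 * (((0 : R)) ^ 2 - (p₂)) ^ 2 - 2 * ((0 : R)) * (((0 : R)) ^ 3 - 3 * ((0 : R)) * (p₂) + 2 * (p₃)) = 3 * p₂ ^ 2 := by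
  ring

end HsemiregIsogeny1.SquareDoorPairsM
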